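import Summits.Parity.BatemanHorn.Theorems.RoughValueTransportDefs
import Summits.Parity.BatemanHorn.Theorems.RoughValueTransportBalancedSemiprimeLayerQuadraticDictionary
import Summits.Parity.BatemanHorn.Theorems.RoughValueTransportBalancedSemiprimeLayerLinearLayer
import Summits.Parity.BatemanHorn.Theorems.RoughValueTransportBalancedSemiprimeLayerUniformTypeI
import Summits.Parity.BatemanHorn.Theorems.RoughValueTransportBalancedSemiprimeLayerTwistedHooley
import Summits.Parity.BatemanHorn.Theorems.RoughValueTransportBalancedSemiprimeLayerQuadraticSieve
import Summits.Parity.BatemanHorn.Theorems.BalancedSemiprimeLayer.Negative.NatDegreePos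
import Summits.Parity.BatemanHorn.Theorems.BalancedSemiprimeLayer.Negative.Structure
import Summits.Parity.BatemanHorn.Theorems.BalancedSemiprimeLayer.Negative.Decoration
import Summits.Parity.BatemanHorn.Theorems.BalancedSemiprimeLayer.Negative.HigherLayerNecessary
import Summits.Parity.BatemanHorn.Theses.RoughValueTransport
import Literature.NumberTheory.Sieve.BatemanHorn
import HarnessLib

/-!
# Route `RoughValueTransport`, crux `BalancedSemiprimeLayer` (stmt-Parity-9469), line
# `smooth-modulus-twisted-hooley`: the crux for every Bateman–Horn system of degree ≤ 2, and the
# transfer stub `stub_transfer` (the crux ⟸ its degree-≥-3 residue `stub_higherLayer`)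

All six working stubs of the line have landed:
`stub_coordLayerMono` (`RoughValueTransportDefs`), `stub_linearLayer` (`…LinearLayer`),
`stub_twistedHooley` (`…TwistedHooley`, analytic core `Literature…QuadraticRootsTwistedHooley`),
`stub_uniformTypeI` (`…UniformTypeI`, core `Literature…PolynomialCongruencesTypeIUniform`),
`stub_quadraticDictionary` (`…QuadraticDictionary`) and `stub_quadraticSieve` (`…QuadraticSieve*`).
This file composes them:

* `DegreeLeTwo.coordLayerThin_quadratic_of_parts` + the landed stubs give `CoordLayerThin f i` for
  every coordinate of degree `1` or `2` of a Bateman–Horn system;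
* `layerConclusion_of_natDegree_le_two`: the conclusion of `BalancedSemiprimeLayer` for EVERY
  Bateman–Horn system all of whose coordinates have degree `≤ 2` (unconditional);
* `stub_transfer`: the registered transfer stub — the statement of the one open stub
  `stub_higherLayer` (`CoordLayerThin` for coordinates of degree `≥ 3`, = the route's `LayerHigher`)
  implies the crux;
* `balancedSemiprimeLayer_iff_higherLayer`: together with the disprover's
  `Negative.higherLayer_of_balancedSemiprimeLayer` (p75295) the crux is EQUIVALENT to that residue.
-/

namespace Summit.Parity.BatemanHorn.Cruxes.BalancedSemiprimeLayer.SmoothModulusTwistedHooley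

open Polynomial Filter Finset
open Literature.NumberTheory.Sieve
open Summit.Parity.BatemanHorn.Theorems.BalancedSemiprimeLayer.Negative
  (natDegree_pos_of_isBatemanHornSystem balancedSemiprimeLayer_iff_pos
    higherLayer_of_balancedSemiprimeLayer tendsto_mul_div_log_pow_atTop)
open Summit.Parity.BatemanHorn.Theses.RoughValueTransport (BalancedSemiprimeLayer)

namespace DegreeLeTwo

/-- **The quadratic coordinate from the dictionary and the sieve** (hypothesis form, real proof):
given `ε`, take `c` and `δ₀(ε/2)` from the sieve part, `δ := min(δ₀, 1/4)`, and
`E_{f,i}(x, δ) ≤ 2 + #pairFamily ≤ 2 + (ε/2)x/(log x)^k ≤ εx/(log x)^k` eventually. [folklore] -/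
theorem coordLayerThin_quadratic_of_parts
    (hdict : ∀ (k : ℕ) (f : Fin k → ℤ[X]), IsBatemanHornSystem f → ∀ i : Fin k, (f i).natDegree = 2 →
      ∀ δ c : ℝ, 0 < δ → δ ≤ 1 / 4 → 0 < c → c ≤ 1 / 4 →
        ∀ᶠ x : ℕ in atTop, coordLayer f i δ x ≤ 2 + #(pairFamily f i δ c x))
    (hsieve : ∀ (k : ℕ) (f : Fin k → ℤ[X]), IsBatemanHornSystem f → ∀ i : Fin k, (f i).natDegree = 2 →
      UniformTypeI (f i) → ∃ c : ℝ, 0 < c ∧ c ≤ 1 / 4 ∧ ∀ ε : ℝ, 0 < ε → ∃ δ₀ : ℝ, 0 < δ₀ ∧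
        ∀ δ : ℝ, 0 < δ → δ ≤ δ₀ → ∀ᶠ x : ℕ in atTop,
          (#(pairFamily f i δ c x) : ℝ) ≤ ε * (x : ℝ) / Real.log x ^ k) :
    ∀ (k : ℕ) (f : Fin k → ℤ[X]), IsBatemanHornSystem f →
      ∀ i : Fin k, (f i).natDegree = 2 → UniformTypeI (f i) → CoordLayerThin f i := by
  intro k f hf i hi hT ε hε
  obtain ⟨c, hc0, hc4, H⟩ := hsieve k f hf i hi hT
  obtain ⟨δ₀, hδ₀, Hδ⟩ := H (ε / 2) (half_pos hε)
  have hδpos : 0 < min δ₀ (1 / 4) := lt_min hδ₀ (by norm_num)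
  refine ⟨min δ₀ (1 / 4), hδpos, min_le_right _ _, ?_⟩
  filter_upwards [hdict k f hf i hi (min δ₀ (1 / 4)) c hδpos (min_le_right _ _) hc0 hc4,
    Hδ (min δ₀ (1 / 4)) hδpos (min_le_left _ _),
    (tendsto_mul_div_log_pow_atTop (half_pos hε) k).eventually_ge_atTop 2] with x h1 h2 h3
  have h1' : (coordLayer f i (min δ₀ (1 / 4)) x : ℝ) ≤ 2 + (#(pairFamily f i (min δ₀ (1 / 4)) c x) : ℝ) := by
    exact_mod_cast h1
  have : (coordLayer f i (min δ₀ (1 / 4)) x : ℝ) ≤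
      ε / 2 * x / Real.log x ^ k + ε / 2 * x / Real.log x ^ k := by linarith
  calc (coordLayer f i (min δ₀ (1 / 4)) x : ℝ)
      ≤ ε / 2 * x / Real.log x ^ k + ε / 2 * x / Real.log x ^ k := this
    _ = ε * x / Real.log x ^ k := by ring

/-- Abstract union bound. [folklore] -/
theorem card_le_card_add_sum_card {k : ℕ} (S A : Finset ℕ) (B : Fin k → Finset ℕ)
    (h : S ⊆ A ∪ Finset.univ.biUnion B) : #S ≤ #A + ∑ i, #(B i) :=
  calc #S ≤ #(A ∪ Finset.univ.biUnion B) := card_le_card h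
    _ ≤ #A + #(Finset.univ.biUnion B) := card_union_le _ _
    _ ≤ #A + ∑ i, #(B i) := by gcongr; exact card_biUnion_le

/-- **The crux's count is at most (jointly rough ∧ all values prime) + ∑ᵢ E_{f,i}.** [folklore] -/
theorem card_cruxFilter_le {k : ℕ} (f : Fin k → ℤ[X]) (δ : ℝ) (x : ℕ) :
    #((Icc 1 x).filter (fun n : ℕ => ∀ i, 0 < (f i).eval (n : ℤ) ∧
        ∀ p ∈ range ⌈(x : ℝ) ^ (((f i).natDegree : ℝ) * (1 - δ) / 2)⌉₊,
          p.Prime → ¬ ((p : ℤ) ∣ (f i).eval (n : ℤ)))) ≤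
      #((Icc 1 x).filter (fun n : ℕ => (∀ i, 0 < (f i).eval (n : ℤ) ∧
        ∀ p ∈ range ⌈(x : ℝ) ^ (((f i).natDegree : ℝ) * (1 - δ) / 2)⌉₊,
          p.Prime → ¬ ((p : ℤ) ∣ (f i).eval (n : ℤ))) ∧ ∀ i, ((f i).eval (n : ℤ)).toNat.Prime)) +
      ∑ i, coordLayer f i δ x := by
  unfold coordLayer
  refine card_le_card_add_sum_card _ _ _ fun n hn => ?_
  rw [mem_filter] at hn
  by_cases hall : ∀ i, ((f i).eval (n : ℤ)).toNat.Prime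
  · exact mem_union.mpr (Or.inl (mem_filter.mpr ⟨hn.1, hn.2, hall⟩))
  · push Not at hall
    obtain ⟨i, hi⟩ := hall
    exact mem_union.mpr (Or.inr (mem_biUnion.mpr ⟨i, mem_univ i, mem_filter.mpr ⟨hn.1, hn.2, hi⟩⟩))

/-- Jointly rough with all values prime `⇒` counted by `polyPrimeCount`. [folklore] -/
theorem card_filter_allPrime_le_polyPrimeCount {k : ℕ} (f : Fin k → ℤ[X]) (δ : ℝ) (x : ℕ) :
    #((Icc 1 x).filter (fun n : ℕ => (∀ i, 0 < (f i).eval (n : ℤ) ∧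
        ∀ p ∈ range ⌈(x : ℝ) ^ (((f i).natDegree : ℝ) * (1 - δ) / 2)⌉₊,
          p.Prime → ¬ ((p : ℤ) ∣ (f i).eval (n : ℤ))) ∧ ∀ i, ((f i).eval (n : ℤ)).toNat.Prime)) ≤
      polyPrimeCount f x := by
  unfold polyPrimeCount
  refine card_le_card fun n hn => ?_
  simp only [mem_filter, mem_Icc] at hn
  simp only [mem_filter, mem_range]
  exact ⟨by omega, fun i => ⟨(hn.2.1 i).1, hn.2.2 i⟩⟩

/-! ### The line's reach without the open residual: every system of degree `≤ 2` -/

/-- **The crux's conclusion for EVERY Bateman–Horn system all of whose coordinates have degree `≤ 2`**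
(k-tuple / twin / Sophie Germain systems, `X² + 1` and all Hardy–Littlewood quadratic systems, mixed
systems such as `(X, X²+X+1)`), from the stubs OTHER than `stub_higherLayer` — i.e. unconditional as
soon as `stub_twistedHooley` and `stub_quadraticSieve` land (the others have landed).  Same proof as
`balancedSemiprimeLayer_of_parts`, the degree trichotomy never reaching `≥ 3`. [folklore] -/
theorem layerConclusion_of_natDegree_le_two :
    ∀ (k : ℕ) (f : Fin k → ℤ[X]), IsBatemanHornSystem f → (∀ i, (f i).natDegree ≤ 2) →
      ∀ ε : ℝ, 0 < ε → ∃ δ : ℝ, 0 < δ ∧ δ ≤ 1 / 4 ∧ ∀ᶠ x : ℕ in atTop,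
        (((Icc 1 x).filter (fun n : ℕ => ∀ i, 0 < (f i).eval (n : ℤ) ∧
            ∀ p ∈ range ⌈(x : ℝ) ^ (((f i).natDegree : ℝ) * (1 - δ) / 2)⌉₊,
              p.Prime → ¬ ((p : ℤ) ∣ (f i).eval (n : ℤ)))).card : ℝ) ≤
          (polyPrimeCount f x : ℝ) + ε * (x : ℝ) / Real.log x ^ k := by
  intro k f hf hdeg ε hε
  rcases Nat.eq_zero_or_pos k with hk0 | hk
  · -- `k = 0`: the proved `k = 0` slice of the crux
    subst hk0
    refine ⟨1 / 4, by norm_num, le_rfl, Eventually.of_forall fun x => ?_⟩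
    have h1 : #((Icc 1 x).filter (fun n : ℕ => ∀ i : Fin 0, 0 < (f i).eval (n : ℤ) ∧
        ∀ p ∈ range ⌈(x : ℝ) ^ (((f i).natDegree : ℝ) * (1 - 1 / 4) / 2)⌉₊,
          p.Prime → ¬ ((p : ℤ) ∣ (f i).eval (n : ℤ)))) ≤ x := by
      calc _ ≤ (Icc 1 x).card := card_filter_le _ _
        _ = x := by simp
    have h2 : polyPrimeCount f x = x + 1 := by
      unfold polyPrimeCount
      rw [Finset.filter_true_of_mem (fun n _ => fun i => i.elim0), Finset.card_range]
    have h1' : (#((Icc 1 x).filter (fun n : ℕ => ∀ i : Fin 0, 0 < (f i).eval (n : ℤ) ∧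
        ∀ p ∈ range ⌈(x : ℝ) ^ (((f i).natDegree : ℝ) * (1 - 1 / 4) / 2)⌉₊,
          p.Prime → ¬ ((p : ℤ) ∣ (f i).eval (n : ℤ)))) : ℝ) ≤ x := by exact_mod_cast h1
    have h3 : (0 : ℝ) ≤ ε * x / Real.log x ^ 0 := by positivity
    rw [h2]; push_cast; linarith
  have hquad := coordLayerThin_quadratic_of_parts stub_quadraticDictionary stub_quadraticSieve
  have hthin : ∀ i : Fin k, CoordLayerThin f i := by
    intro i
    have hpos := natDegree_pos_of_isBatemanHornSystem hf i
    rcases Nat.lt_or_ge (f i).natDegree 2 with hlt | hge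
    · exact stub_linearLayer k f hf i (by omega)
    · have heq : (f i).natDegree = 2 := le_antisymm (hdeg i) hge
      exact hquad k f hf i heq
        (stub_uniformTypeI (f i) heq (hf.irreducible i) (stub_twistedHooley (f i) heq (hf.irreducible i)))
  have hk' : (0 : ℝ) < k := by exact_mod_cast hk
  choose δ hδpos hδle hδev using fun i => hthin i (ε / k) (div_pos hε hk')
  have hne : (Finset.univ : Finset (Fin k)).Nonempty := ⟨⟨0, hk⟩, mem_univ _⟩
  set δ₀ : ℝ := Finset.univ.inf' hne δ with hδ₀
  have hδ₀le : ∀ i, δ₀ ≤ δ i := fun i => Finset.inf'_le δ (mem_univ i)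
  refine ⟨δ₀, (Finset.lt_inf'_iff hne).mpr fun i _ => hδpos i,
    (hδ₀le ⟨0, hk⟩).trans (hδle _), ?_⟩
  have hall : ∀ᶠ x : ℕ in atTop, ∀ i, (coordLayer f i (δ i) x : ℝ) ≤ ε / k * (x : ℝ) / Real.log x ^ k :=
    eventually_all.mpr hδev
  filter_upwards [hall] with x hx
  have h1 := card_cruxFilter_le f δ₀ x
  have h2 : ∀ i, coordLayer f i δ₀ x ≤ coordLayer f i (δ i) x :=
    fun i => coordLayer_mono f i (hδ₀le i) x
  have h3 := card_filter_allPrime_le_polyPrimeCount f δ₀ x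
  have h1' : (#((Icc 1 x).filter (fun n : ℕ => ∀ i, 0 < (f i).eval (n : ℤ) ∧
        ∀ p ∈ range ⌈(x : ℝ) ^ (((f i).natDegree : ℝ) * (1 - δ₀) / 2)⌉₊,
          p.Prime → ¬ ((p : ℤ) ∣ (f i).eval (n : ℤ)))) : ℝ) ≤
      (polyPrimeCount f x : ℝ) + ∑ i, (coordLayer f i (δ i) x : ℝ) := by
    have h4 : #((Icc 1 x).filter (fun n : ℕ => ∀ i, 0 < (f i).eval (n : ℤ) ∧
        ∀ p ∈ range ⌈(x : ℝ) ^ (((f i).natDegree : ℝ) * (1 - δ₀) / 2)⌉₊,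
          p.Prime → ¬ ((p : ℤ) ∣ (f i).eval (n : ℤ)))) ≤
        polyPrimeCount f x + ∑ i, coordLayer f i (δ i) x :=
      h1.trans (add_le_add h3 (sum_le_sum fun i _ => h2 i))
    exact_mod_cast h4
  refine h1'.trans ?_
  have hsum : ∑ i : Fin k, (coordLayer f i (δ i) x : ℝ) ≤ ∑ _i : Fin k, ε / k * (x : ℝ) / Real.log x ^ k :=
    sum_le_sum fun i _ => hx i
  have hconst : ∑ _i : Fin k, ε / k * (x : ℝ) / Real.log x ^ k = ε * (x : ℝ) / Real.log x ^ k := by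
    rw [sum_const, card_univ, Fintype.card_fin, nsmul_eq_mul]
    rw [← mul_div_assoc]
    congr 1
    field_simp
  linarith

end DegreeLeTwo

open DegreeLeTwo in
/-- **The crux reduces EXACTLY to its degree-`≥ 3` residual**: `BalancedSemiprimeLayer` follows from the
statement of `stub_higherLayer` alone (every other registered stub of the line has LANDED).  This is the
line's composition `balancedSemiprimeLayer_of_parts` with the five landed stubs plugged in; the remaining
hypothesis is the route's foreseen split item `LayerHigher` in coordinate form (an open problem: balanced
prime factors `p₁ ~ x^{d(1−δ)/2} > x` exceed the number of terms). [folklore] -/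
theorem stub_transfer :
    (∀ (k : ℕ) (f : Fin k → ℤ[X]), IsBatemanHornSystem f →
      ∀ i : Fin k, 3 ≤ (f i).natDegree → CoordLayerThin f i) → BalancedSemiprimeLayer := by
  intro hhigh
  rw [balancedSemiprimeLayer_iff_pos]
  intro k f hk hf ε hε
  have hquad := coordLayerThin_quadratic_of_parts stub_quadraticDictionary stub_quadraticSieve
  have hthin : ∀ i : Fin k, CoordLayerThin f i := by
    intro i
    have hpos := natDegree_pos_of_isBatemanHornSystem hf i
    rcases Nat.lt_trichotomy (f i).natDegree 2 with hlt | heq | hgt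
    · exact stub_linearLayer k f hf i (by omega)
    · exact hquad k f hf i heq
        (stub_uniformTypeI (f i) heq (hf.irreducible i) (stub_twistedHooley (f i) heq (hf.irreducible i)))
    · exact hhigh k f hf i (by omega)
  have hk' : (0 : ℝ) < k := by exact_mod_cast hk
  choose δ hδpos hδle hδev using fun i => hthin i (ε / k) (div_pos hε hk')
  have hne : (Finset.univ : Finset (Fin k)).Nonempty := ⟨⟨0, hk⟩, mem_univ _⟩
  set δ₀ : ℝ := Finset.univ.inf' hne δ with hδ₀
  have hδ₀le : ∀ i, δ₀ ≤ δ i := fun i => Finset.inf'_le δ (mem_univ i)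
  refine ⟨δ₀, (Finset.lt_inf'_iff hne).mpr fun i _ => hδpos i,
    (hδ₀le ⟨0, hk⟩).trans (hδle _), ?_⟩
  have hall : ∀ᶠ x : ℕ in atTop, ∀ i, (coordLayer f i (δ i) x : ℝ) ≤ ε / k * (x : ℝ) / Real.log x ^ k :=
    eventually_all.mpr hδev
  filter_upwards [hall] with x hx
  have h1 := card_cruxFilter_le f δ₀ x
  have h2 : ∀ i, coordLayer f i δ₀ x ≤ coordLayer f i (δ i) x :=
    fun i => coordLayer_mono f i (hδ₀le i) x
  have h3 := card_filter_allPrime_le_polyPrimeCount f δ₀ x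
  have h1' : (#((Icc 1 x).filter (fun n : ℕ => ∀ i, 0 < (f i).eval (n : ℤ) ∧
        ∀ p ∈ range ⌈(x : ℝ) ^ (((f i).natDegree : ℝ) * (1 - δ₀) / 2)⌉₊,
          p.Prime → ¬ ((p : ℤ) ∣ (f i).eval (n : ℤ)))) : ℝ) ≤
      (polyPrimeCount f x : ℝ) + ∑ i, (coordLayer f i (δ i) x : ℝ) := by
    have h4 : #((Icc 1 x).filter (fun n : ℕ => ∀ i, 0 < (f i).eval (n : ℤ) ∧
        ∀ p ∈ range ⌈(x : ℝ) ^ (((f i).natDegree : ℝ) * (1 - δ₀) / 2)⌉₊,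
          p.Prime → ¬ ((p : ℤ) ∣ (f i).eval (n : ℤ)))) ≤
        polyPrimeCount f x + ∑ i, coordLayer f i (δ i) x :=
      h1.trans (add_le_add h3 (sum_le_sum fun i _ => h2 i))
    exact_mod_cast h4
  refine h1'.trans ?_
  have hsum : ∑ i : Fin k, (coordLayer f i (δ i) x : ℝ) ≤ ∑ _i : Fin k, ε / k * (x : ℝ) / Real.log x ^ k :=
    sum_le_sum fun i _ => hx i
  have hconst : ∑ _i : Fin k, ε / k * (x : ℝ) / Real.log x ^ k = ε * (x : ℝ) / Real.log x ^ k := by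
    rw [sum_const, card_univ, Fintype.card_fin, nsmul_eq_mul]
    rw [← mul_div_assoc]
    congr 1
    field_simp
  linarith

export DegreeLeTwo (layerConclusion_of_natDegree_le_two)

/-- **The crux is equivalent to its degree-`≥ 3` residue.**  `BalancedSemiprimeLayer` holds iff
every coordinate of degree `≥ 3` of every Bateman–Horn system has a thin rough-composite layer
(`CoordLayerThin`, the statement of the open stub `stub_higherLayer` = the route's `LayerHigher`):
`⟸` is `stub_transfer` (this line), `⟹` is the disprover's
`Negative.higherLayer_of_balancedSemiprimeLayer`. [folklore] -/
theorem balancedSemiprimeLayer_iff_higherLayer :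
    BalancedSemiprimeLayer ↔
      (∀ (k : ℕ) (f : Fin k → ℤ[X]), IsBatemanHornSystem f →
        ∀ i : Fin k, 3 ≤ (f i).natDegree → CoordLayerThin f i) :=
  ⟨higherLayer_of_balancedSemiprimeLayer, stub_transfer⟩

end Summit.Parity.BatemanHorn.Cruxes.BalancedSemiprimeLayer.SmoothModulusTwistedHooley
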